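import Mathlib
import HarnessLib
import Summits.ValiantsHypothesis.ValiantsHypothesis.Theses.NewtonUnitEquations
import Summits.ValiantsHypothesis.ValiantsHypothesis.Theorems.NewtonUnitEquationsKpttTransfer
import Summits.ValiantsHypothesis.ValiantsHypothesis.Theorems.NewtonUnitEquationsLogFactorBoundCruxEquiv

/-!
# Route NewtonUnitEquations — support item `KpttTransferLog` (stmt-ValiantsHypothesis-16113)

KPTT 2015, Theorem 1 (arXiv:1308.2286, §3) re-run in the LOG-FACTOR regime: the regime-R1 bound
`LogFactorBound` (route item stmt-ValiantsHypothesis-16048, inlined verbatim as the hypothesis),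

  `m ≤ ⌊log₂ k⌋ → #vert Newt(Σ_{i<k} Π_{j<m} f_ij) ≤ (k t + 2)^b` for `t`-sparse bivariate `f_ij` over `ℂ`,

already implies that the permanent family `(per_n)_n` is not a `VP` family over `ℂ`.

Proof: composition of two theorems already in the tree —

* `NewtonUnitEquationsLogFactorBound.newtonTauWeak_of_logFactorBound`
  (`Theorems/NewtonUnitEquationsLogFactorBoundCruxEquiv.lean`): R1 implies the crux `NewtonTauWeak`
  (pad the `k` products with `2^m` zero products, so that `m ≤ log₂ (k + 2^m)`; then
  `((k + 2^m) t + 2)^b ≤ 2^{2bm} (k t + 2)^b`), and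
* `kpttTransfer_proof` (`Theorems/NewtonUnitEquationsKpttTransfer.lean`, = the Literature discharge
  `KPTT.theorem1_holds`): `NewtonTauWeak → ¬ IsVPFamily (fun n => perPoly (Fin n) ℂ)`.

This is the same argument as the crux-strategist's stand-alone sketch
`Cruxes/NewtonTauWeak/RetargetTransfer.lean` (`KPTT.kpttTransferLog_holds`, which pads inside the proof of
Theorem 1 instead of factoring through `NewtonTauWeak`); factoring through the crux keeps this file to one line
and introduces no new definitions.  With this item the deciding theorem can be re-glued to
(`LogFactorBound`, `KpttTransferLog`) (`Cruxes/NewtonTauWeak/AdmissibleRetarget.lean`, `closes_log`).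

No definitions, no named facts, no `sorry`.
-/

-- `<Sub> = <Summit>` for this single-conjunct summit (D-0017): silence dupNamespace
set_option linter.dupNamespace false

namespace Summit.ValiantsHypothesis.ValiantsHypothesis.Theorems

open scoped BigOperators
open Summit.ValiantsHypothesis.ValiantsHypothesis.Theses.NewtonUnitEquations (NewtonTauWeak KpttTransfer)

/-- **`KpttTransferLog`** (support item stmt-ValiantsHypothesis-16113 of route NewtonUnitEquations; KPTT
arXiv:1308.2286 Thm 1 in the log-factor regime): the regime-R1 bound `LogFactorBound` — for sums of `k`
products of `m ≤ ⌊log₂ k⌋` `t`-sparse bivariate polynomials over `ℂ` the Newton polygon has `≤ (k t + 2)^b`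
vertices — implies that `(per_n)_n` is not a `VP` family over `ℂ`.  Proof: R1 gives the weak Newton-polygon
τ-conjecture `NewtonTauWeak` by free zero-padding (`newtonTauWeak_of_logFactorBound`), and KPTT Theorem 1
(`kpttTransfer_proof` = `KPTT.theorem1_holds`) transfers that to `¬ IsVPFamily per`. -/
theorem kpttTransferLog_proof :
    (∃ b : ℕ, ∀ (k m t : ℕ) (f : Fin k → Fin m → MvPolynomial (Fin 2) ℂ), m ≤ Nat.log 2 k →
      (∀ i j, (f i j).support.card ≤ t) →
        (Set.extremePoints ℝ (convexHull ℝ ((fun e : Fin 2 →₀ ℕ => fun i : Fin 2 => ((e i : ℕ) : ℝ)) ''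
          ((∑ i, ∏ j, f i j).support : Set (Fin 2 →₀ ℕ))))).ncard ≤ (k * t + 2) ^ b) →
    ¬ Literature.Computability.AlgebraicComplexity.IsVPFamily
      (fun n => Literature.Computability.AlgebraicComplexity.perPoly (Fin n) ℂ) := by
  intro hR1
  have hX : NewtonTauWeak := NewtonUnitEquationsLogFactorBound.newtonTauWeak_of_logFactorBound hR1
  have hT : KpttTransfer := kpttTransfer_proof
  unfold Summit.ValiantsHypothesis.ValiantsHypothesis.Theses.NewtonUnitEquations.KpttTransfer at hT
  exact hT hX

end Summit.ValiantsHypothesis.ValiantsHypothesis.Theorems
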